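import Mathlib.NumberTheory.Padics.PadicNumbers
import Literature.AnabelianGeometry.EtaleTheta.LogDivisorModelTateTowerArithmetic
import Literature.AnabelianGeometry.EtaleTheta.DivisorMonoidsOfGaloisCovering

/-!
# [EtTh] Def. 3.1 / Def. 3.3 / §3 p.72: the arithmetic Tate tower is non-degenerate and its parameter record is
# inhabited (`ℚ` with the `p`-adic valuation)

S. Mochizuki, *The étale theta function …*, Publ. RIMS **45** (2009) [MochizukiEtTh2009], §3: Def. 3.1 / Prop. 3.2
(PRIMS PDF p.70), Def. 3.3 (iii) (p.73), `D₀ → D^cnst` (p.72) [cite: MochizukiEtTh2009, Def 3.3 p.73].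

Sequel (abc-iut cell, W6 seat d058 lineage, gen 3) to `LogDivisorModelTateTowerArithmetic.lean` (class (b) model
`TateTowerArith.Datum.model/action/constField`).  Recorded here:
* non-degeneracy of the GEOMETRY: `Datum.coordU` / **`Datum.coordU_not_mem_fZero`** — the Tate coordinate `U` is a
  log-meromorphic, non-constant element of `B₀(Z_∞)` (`B₀ ≠ F₀`); `Datum.nonempty_divisorMonoids` — the Def. 3.3
  (iii) data `DivisorMonoids.ofGaloisAction` exist at this action;
* non-triviality of the CONSTANT-FIELD FUNCTOR: **`Datum.constQuot_leftRegular_mk_eq_iff`** — in `N∖(G/1)` (the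
  constant field `Spec L` of `Z^log_∞` with its `Aut(L/K)`-action) a point and its `g`-translate have the same class
  iff `g ∈ ℤ × 1`; so `D₀ → D^cnst` SEES `Aut(L/K)` (contrast: trivial on the bare skeleton,
  `TateTower.subsingleton_constQuotObj`);
* INHABITANT of the parameter record (class (b) NV): **`Datum.rat p : Datum ℚ ℚ`** — the `p`-adic valuation
  `Rat.padicValuation p`, `q = p` (`v p = exp(−1)`), `Aut(ℚ/ℚ) = 1`, and Prop. 3.2 (iii) for `ℚ^×` PROVED
  (`Rat.units_eq_one_of_forall_exists_pow_eq`: an infinitely divisible nonzero rational is `1`, by the growth of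
  numerators/denominators of `N`-th roots); hence `nonempty_datum`, and every theorem of the model file is
  non-vacuous (`constGaloisLaw_rat`).  HONEST LABEL: this inhabitant has TRIVIAL `Aut(L/K)`; an inhabitant with
  non-trivial constant-field Galois group needs a number field with a Galois-invariant discrete valuation (e.g. an
  inert prime), not built here.
HONEST FRAMING: consistency witnesses for typed interfaces; nothing here bears on [IUTchIII] Cor. 3.12; no side taken;
typed ≠ proved.
-/

noncomputable section

namespace Literature.AnabelianGeometry.EtaleTheta

open CategoryTheory

namespace LogDivisorModel.TateTowerArith.Datum

variable {K L : Type} [Field K] [Field L] [Algebra K L] (D : Datum K L)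

/-! ## Non-degeneracy of the geometry and of the constant-field functor -/

/-- The Tate coordinate `U = 1·U^1` as an equivariant family on the regular `G`-set (the covering `Z_∞` itself):
`g ↦ g·U`. [cite: MochizukiEtTh2009, Def 3.3 p.73] -/
def coordU : D.action.bZero (Action.leftRegular (Grp K L)) :=
  ⟨fun g => D.action.actFn g ((1 : Lˣ), Multiplicative.ofAdd (1 : ℤ)), fun _ => trivial, fun g h => by
    change D.action.actFn ((Action.leftRegular (Grp K L)).ρ g h) _ = _
    rw [Action.ofMulAction_apply, smul_eq_mul, map_mul, MulAut.mul_apply]⟩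

/-- **`B₀(Z_∞) ≠ F₀(Z_∞)` in the arithmetic tower**: `U` is NOT constant. [cite: MochizukiEtTh2009, Def 3.3 p.73] -/
theorem coordU_not_mem_fZero : D.coordU ∉ D.action.fZero (Action.leftRegular (Grp K L)) := by
  intro h
  have h1 := h (1 : Grp K L)
  change D.action.actFn 1 ((1 : Lˣ), Multiplicative.ofAdd (1 : ℤ)) ∈ D.model.const at h1
  rw [map_one, MulAut.one_apply] at h1
  obtain ⟨c, hc⟩ := h1
  have h2 := congrArg (fun f : Lˣ × Multiplicative ℤ => Multiplicative.toAdd f.2) hc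
  change Multiplicative.toAdd (1 : Multiplicative ℤ) = Multiplicative.toAdd (Multiplicative.ofAdd (1 : ℤ)) at h2
  rw [toAdd_one, toAdd_ofAdd] at h2
  exact zero_ne_one h2

/-- **The Def. 3.3 (iii) data of the arithmetic Tate tower exist** (`DivisorMonoids.ofGaloisAction` at this action).
[cite: MochizukiEtTh2009, Def 3.3 p.73] -/
theorem nonempty_divisorMonoids (D : Datum K L) : Nonempty (DivisorMonoids.{1, 0, 0} (Action (Type 0) (Grp K L))) :=
  ⟨DivisorMonoids.ofGaloisAction D.action D.cuspLaws⟩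

/-- **The constant-field functor is NON-trivial on the arithmetic tower**: in `N∖(G/1)` (the constant field of
`Z^log_∞` itself, `= Spec L` with its `Aut(L/K)`-action) a point `s` and its translate `g·s` have the same class iff
`g ∈ ℤ × 1`. [cite: MochizukiEtTh2009, Def 3.3 p.73] -/
theorem constQuot_leftRegular_mk_eq_iff (s : (Action.leftRegular (Grp K L)).V) (g : Grp K L) :
    (Quotient.mk (D.action.constOrbitSetoid (Action.leftRegular (Grp K L))) s :
        (D.action.constQuotObj (Action.leftRegular (Grp K L))).V) =
      Quotient.mk _ ((Action.leftRegular (Grp K L)).ρ g s) ↔ g.2 = 1 := by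
  rw [GaloisAction.constQuot_mk_eq_mk_iff]
  change (∃ n ∈ D.action.constInertia, n * (show Grp K L from s) = g * (show Grp K L from s)) ↔ _
  constructor
  · rintro ⟨n, hn, hng⟩
    rw [← mul_right_cancel hng]
    exact (D.mem_constInertia_iff n).1 hn
  · intro hg
    exact ⟨g, (D.mem_constInertia_iff g).2 hg, rfl⟩

end LogDivisorModel.TateTowerArith.Datum

/-! ## Prop. 3.2 (iii) for `ℚ^×` and the inhabitant of the parameter record -/

/-- If `d ^ N = r` in `ℚ` with `N = r.den ≥ 1`, then `r.den = 1` (denominators of `N`-th roots grow like `2^N`).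
[folklore] -/
private theorem Rat.den_eq_one_of_pow_eq (r d : ℚ) (h : d ^ r.den = r) : r.den = 1 := by
  have hden : r.den = d.den ^ r.den := by
    conv_lhs => rw [← h]
    rw [Rat.den_pow]
  by_contra hne
  have h2 : 2 ≤ d.den := by
    by_contra hlt
    have hd1 : d.den = 1 := by have := d.den_pos; omega
    rw [hd1, one_pow] at hden
    exact hne hden
  have hle : 2 ^ r.den ≤ d.den ^ r.den := Nat.pow_le_pow_left h2 _
  have hlt : r.den < 2 ^ r.den := Nat.lt_two_pow_self
  omega

/-- If `d ^ N = r ≠ 0` in `ℚ` with `N = |r.num| ≥ 1`, then `|r.num| = 1`. [folklore] -/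
private theorem Rat.natAbs_num_eq_one_of_pow_eq (r d : ℚ) (hr : r ≠ 0) (h : d ^ r.num.natAbs = r) :
    r.num.natAbs = 1 := by
  have hnum : r.num.natAbs = d.num.natAbs ^ r.num.natAbs := by
    conv_lhs => rw [← h, Rat.num_pow, Int.natAbs_pow]
  have hpos : 0 < r.num.natAbs := Int.natAbs_pos.2 (Rat.num_ne_zero.2 hr)
  by_contra hne
  have h2 : 2 ≤ d.num.natAbs := by
    by_contra hlt
    interval_cases hd : d.num.natAbs
    · rw [zero_pow hpos.ne'] at hnum; omega
    · rw [one_pow] at hnum; exact hne hnum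
  have hle : 2 ^ r.num.natAbs ≤ d.num.natAbs ^ r.num.natAbs := Nat.pow_le_pow_left h2 _
  have hlt : r.num.natAbs < 2 ^ r.num.natAbs := Nat.lt_two_pow_self
  omega

/-- **Prop. 3.2 (iii) for the constants `ℚ^×`**: a nonzero rational admitting an `N`-th root for every `N ≥ 1` is `1`.
[cite: MochizukiEtTh2009, Prop 3.2 p.70] -/
theorem Rat.units_eq_one_of_forall_exists_pow_eq (c : ℚˣ) (h : ∀ N : ℕ+, ∃ d : ℚˣ, d ^ (N : ℕ) = c) : c = 1 := by
  have hr : (c : ℚ) ≠ 0 := c.ne_zero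
  -- denominators
  obtain ⟨d₁, hd₁⟩ := h ⟨(c : ℚ).den, (c : ℚ).den_pos⟩
  have hd₁' := congrArg (fun u : ℚˣ => (u : ℚ)) hd₁
  simp only [Units.val_pow_eq_pow_val, PNat.mk_coe] at hd₁'
  have hden : (c : ℚ).den = 1 := Rat.den_eq_one_of_pow_eq (c : ℚ) (d₁ : ℚ) hd₁'
  -- numerators
  obtain ⟨d₂, hd₂⟩ := h ⟨(c : ℚ).num.natAbs, Int.natAbs_pos.2 (Rat.num_ne_zero.2 hr)⟩
  have hd₂' := congrArg (fun u : ℚˣ => (u : ℚ)) hd₂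
  simp only [Units.val_pow_eq_pow_val, PNat.mk_coe] at hd₂'
  have hnum : (c : ℚ).num.natAbs = 1 := Rat.natAbs_num_eq_one_of_pow_eq (c : ℚ) (d₂ : ℚ) hr hd₂'
  -- so `c = ±1`, and `c` is a square
  obtain ⟨d, hd⟩ := h 2
  have hsq : (0 : ℚ) ≤ (c : ℚ) := by
    rw [← hd, Units.val_pow_eq_pow_val]
    exact sq_nonneg _
  have hc : (c : ℚ) = (c : ℚ).num := (Rat.coe_int_num_of_den_eq_one hden).symm
  rcases Int.natAbs_eq_iff.1 hnum with h1 | h1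
  · exact Units.ext (by rw [hc, h1]; rfl)
  · rw [hc, h1] at hsq
    norm_num at hsq

namespace LogDivisorModel.TateTowerArith

/-- **The parameter record is inhabited**: `ℚ` with the `p`-adic valuation, Tate parameter `q = p`.
(`Aut(ℚ/ℚ)` is trivial — honest label in the module docstring.) [cite: MochizukiEtTh2009, Def 3.1 p.70] -/
def Datum.rat (p : ℕ) [Fact p.Prime] : Datum ℚ ℚ where
  v := Rat.padicValuation p
  finiteDimensional := inferInstance
  v_algEquiv σ x := by
    have hx : σ x = x := by
      have h := σ.commutes x
      rwa [Algebra.algebraMap_self_apply] at h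
    rw [hx]
  q := p
  v_q := by
    rw [Algebra.algebraMap_self_apply]
    exact Rat.padicValuation_self p
  eq_one_of_divisible := Rat.units_eq_one_of_forall_exists_pow_eq

/-- Hence `Datum ℚ ℚ` is non-empty. [cite: MochizukiEtTh2009, Def 3.1 p.70] -/
theorem nonempty_datum (p : ℕ) [Fact p.Prime] : Nonempty (Datum ℚ ℚ) := ⟨Datum.rat p⟩

/-- … and the model file's theorems are non-vacuous: e.g. the Galois-correspondence law at the `p`-adic arithmetic
Tate tower over `ℚ`. [cite: MochizukiEtTh2009, Thm 3.7 (iii) p.79] -/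
theorem constGaloisLaw_rat (p : ℕ) [Fact p.Prime] : (Datum.rat p).action.ConstGaloisLaw :=
  (Datum.rat p).constGaloisLaw

/-- In the `ℚ`-tower the integral constants are exactly the `p`-integral rationals: `c·U^0 ∈ O^▷` iff `v_p c ≤ 1`.
[cite: MochizukiEtTh2009, Prop 3.4 p.74] -/
theorem rat_emb_mem_intConst_iff (p : ℕ) [Fact p.Prime] (c : ℚˣ) :
    (Datum.rat p).constField.emb c ∈ (Datum.rat p).model.intConst ↔ Rat.padicValuation p (c : ℚ) ≤ 1 :=
  (Datum.rat p).constField.emb_mem_intConst_iff c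

end LogDivisorModel.TateTowerArith

end Literature.AnabelianGeometry.EtaleTheta

end
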